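import Literature.Topology.FourManifolds.DehnSurgeryTubularNbhdProofs
import HarnessLib

/-!
# Thin tubular neighbourhoods of knots; pairwise disjoint tubular neighbourhoods of a link

Sibling proof file of `DehnSurgery.lean` / `DehnSurgeryTubularNbhdProofs.lean`, first step towards
the named fact `Literature.Topology.FourManifolds.FramedLink.exists_isSurgery` of `KirbyMovesSurgery.lean` (existence of Dehn
surgery on a framed link: Rolfsen, *Knots and Links* (1976), §9.F; Juhász, *Differential and
Low-Dimensional Topology* (2023), §4.10, Def. 4.95 and the paragraph after it). The relational
integral surgery `Literature.Topology.FourManifolds.IsIntegralSurgeryLink` of `DehnSurgery.lean` asks for *pairwise disjoint*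
oriented tubular neighbourhoods of the components of the link; this file provides them.
Everything here is proved:

* `Literature.SphereEmbedding.tubularNbhdOfRadius K hδ hδr` — the oriented tubular neighbourhood of
  `DehnSurgeryTubularNbhdProofs.lean` (`K.tubularNbhd`, Hirsch's tube over a positively oriented
  normal framing, squeezed to the radius `tubularRadius K`) squeezed instead to any radius
  `0 < δ ≤ tubularRadius K`; its image is `ν̂ (𝕊¹ × B (0, δ))` for the pre-tubular map `ν̂`
  (`range_tubularNbhdOfRadius_subset`);
* `Literature.Topology.FourManifolds.Knot.exists_tubularNbhd_range_subset` — **thin tubes**: every open set containing the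
  knot contains the image of some oriented tubular neighbourhood (tube lemma over the compact
  circle for the continuous pre-tubular map, which is the knot on the zero section);
* `Literature.Topology.FourManifolds.Link.exists_isOpen_pairwise_disjoint` — the components of a link with finitely many
  components (pairwise disjoint compact subsets of the Hausdorff space `𝕊³`) have pairwise disjoint
  open neighbourhoods;
* `Literature.Topology.FourManifolds.Link.exists_tubularNbhd_pairwise_disjoint` — **every link with finitely many components
  has pairwise disjoint oriented tubular neighbourhoods of its components** (Rolfsen (1976), §9.F:
  "disjoint tubular neighbourhoods `N₁, …, Nₙ` of the components").

## References

* M. W. Hirsch, *Differential Topology*, GTM 33 (1976), Ch. 4 §5, Thm. 5.1–5.2 (tubular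
  neighbourhoods; a partial tubular neighbourhood contains a full one). [cite: Hirsch1976, §4.5 Thm 5.2]
* D. Rolfsen, *Knots and Links* (1976), §9.F (surgery along disjoint tubular neighbourhoods of
  the components of a link). [cite: Rolfsen1976, §9.F]
* A. Juhász, *Differential and Low-Dimensional Topology*, LMS Student Texts 104 (2023), §4.10,
  Def. 4.95. [cite: Juhasz2023, §4.10 Def. 4.95]

## Design notes

* No instance (global or local) is registered.
* No declaration in this file uses `sorry`.
-/

open scoped Manifold ContDiff Topology
open Function Set

noncomputable section

namespace Literature.Topology.FourManifolds

/-- Local notation: `𝔼 n` is the model Euclidean space `EuclideanSpace ℝ (Fin n)`. -/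
local notation "𝔼 " n:arg => EuclideanSpace ℝ (Fin n)

/-- Local notation: `𝕊 n` is the unit sphere in `EuclideanSpace ℝ (Fin (n + 1))`. -/
local notation "𝕊 " n:arg => (Metric.sphere (0 : EuclideanSpace ℝ (Fin (n + 1))) 1)

/-- Local notation: the model with corners of `𝕊¹ × ℝ²`. -/
local notation "𝓘₁₂" => (ModelWithCorners.prod (𝓡 1) 𝓘(ℝ, EuclideanSpace ℝ (Fin 2)))

/-! ### The tubular neighbourhood of a knot squeezed to a smaller radius -/

namespace SphereEmbedding

variable (K : SphereEmbedding 1 3)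

/-- **The tubular map of radius `δ`** of a knot: the squeezed tube `tubeδ K δ` lifted to the
manifold `𝕊¹ × ℝ²`, i.e. `ν_δ (u, w) = ν̂ (u, σ_δ w)` with `ν̂ = preTubularMap K` and the squeeze
`σ_δ` of `ℝ²` onto the disc of radius `δ` (`K.tubularMap` is the case `δ = tubularRadius K`).
Hirsch (1976), §4.5, end of the proof of Thm. 5.1. [cite: Hirsch1976, §4.5 Thm 5.1] -/
def tubularMapOfRadius (δ : ℝ) : (𝕊 1) × 𝔼 2 → 𝕊 3 :=
  periodicLift (K.tubeδ δ) (K.norm_tubeδ δ)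

/-- The tubular map of radius `δ` is the pre-tubular map after squeezing the fibre. [folklore] -/
theorem tubularMapOfRadius_apply (δ : ℝ) (p : (𝕊 1) × 𝔼 2) :
    K.tubularMapOfRadius δ p = K.preTubularMap (p.1, squeeze δ p.2) :=
  Subtype.ext rfl

/-- The tubular map of radius `δ` over an angle. [folklore] -/
theorem coe_tubularMapOfRadius_circlePoint (δ t : ℝ) (w : 𝔼 2) :
    (K.tubularMapOfRadius δ (circlePoint t, w) : 𝔼 4) = K.tubeδ δ (t, w) :=
  coe_periodicLift_circlePoint (K.tubeδ_add_two_pi δ) (K.norm_tubeδ δ) t w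

/-- The tubular map of radius `δ` extends the knot. [folklore] -/
@[simp] theorem tubularMapOfRadius_zero (δ : ℝ) (u : 𝕊 1) : K.tubularMapOfRadius δ (u, 0) = K u := by
  rw [tubularMapOfRadius_apply, squeeze_zero, preTubularMap_zero]

/-- The tubular map of radius `δ` is smooth. [folklore] -/
theorem contMDiff_tubularMapOfRadius (δ : ℝ) : ContMDiff 𝓘₁₂ (𝓡 3) ∞ (K.tubularMapOfRadius δ) :=
  contMDiff_periodicLift (K.contDiff_tubeδ _) (K.tubeδ_add_two_pi _) (K.norm_tubeδ _)

/-- The tubular map of radius `δ` is continuous. [folklore] -/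
theorem continuous_tubularMapOfRadius (δ : ℝ) : Continuous (K.tubularMapOfRadius δ) :=
  (K.contMDiff_tubularMapOfRadius δ).continuous

/-- The image of the tubular map of radius `δ > 0` lies in `ν̂ (𝕊¹ × B (0, δ))`. [folklore] -/
theorem range_tubularMapOfRadius_subset {δ : ℝ} (hδ : 0 < δ) :
    range (K.tubularMapOfRadius δ) ⊆ K.preTubularMap '' (univ ×ˢ Metric.ball (0 : 𝔼 2) δ) := by
  rintro _ ⟨p, rfl⟩
  rw [tubularMapOfRadius_apply]
  refine mem_image_of_mem _ (mk_mem_prod (mem_univ _) ?_)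
  rw [Metric.mem_ball, dist_zero_right]
  exact norm_squeeze_lt hδ p.2

variable {K} in
/-- **The tubular map of radius `δ ≤ tubularRadius` is injective**: the squeeze is injective into
the disc of radius `δ ≤ injRadius`, on which the pre-tubular map is injective. [folklore] -/
theorem tubularMapOfRadius_injective {δ : ℝ} (hδ : 0 < δ) (hδr : δ ≤ K.tubularRadius) :
    Injective (K.tubularMapOfRadius δ) := by
  intro p q h
  have hball : ∀ w : 𝔼 2, squeeze δ w ∈ Metric.ball (0 : 𝔼 2) K.injRadius := fun w ↦ by
    rw [Metric.mem_ball, dist_zero_right]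
    exact (norm_squeeze_lt hδ w).trans_le (hδr.trans K.tubularRadius_le_injRadius)
  have hp : (p.1, squeeze δ p.2) ∈ univ ×ˢ Metric.ball (0 : 𝔼 2) K.injRadius :=
    Set.mk_mem_prod (mem_univ _) (hball p.2)
  have hq : (q.1, squeeze δ q.2) ∈ univ ×ˢ Metric.ball (0 : 𝔼 2) K.injRadius :=
    Set.mk_mem_prod (mem_univ _) (hball q.2)
  have h2 : K.preTubularMap (p.1, squeeze δ p.2) = K.preTubularMap (q.1, squeeze δ q.2) := by
    rw [← tubularMapOfRadius_apply, ← tubularMapOfRadius_apply]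
    exact h
  obtain ⟨h1, h3⟩ := Prod.mk_inj.1 (K.injOn_preTubularMap hp hq h2)
  exact Prod.ext h1 (squeeze_injective hδ h3)

variable {K} in
/-- The tubular map of radius `δ ≤ tubularRadius` is a local diffeomorphism everywhere (positive
Jacobian frame determinant, `δ ≤ jacobiRadius`). [folklore] -/
theorem isLocalDiffeomorph_tubularMapOfRadius {δ : ℝ} (hδ : 0 < δ) (hδr : δ ≤ K.tubularRadius) :
    IsLocalDiffeomorph 𝓘₁₂ (𝓡 3) ∞ (K.tubularMapOfRadius δ) := fun p ↦
  isLocalDiffeomorphAt_periodicLift (K.contDiff_tubeδ _) (K.tubeδ_add_two_pi _) (K.norm_tubeδ _)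
    fun t _ ↦ K.fderiv_tubeδ_injective hδ (hδr.trans K.tubularRadius_le_jacobiRadius) (t, p.2)

variable {K} in
/-- The tubular map of radius `δ ≤ tubularRadius` is an immersion. [folklore] -/
theorem isImmersion_tubularMapOfRadius {δ : ℝ} (hδ : 0 < δ) (hδr : δ ≤ K.tubularRadius) :
    Manifold.IsImmersion 𝓘₁₂ (𝓡 3) ∞ (K.tubularMapOfRadius δ) :=
  Manifold.IsImmersionOfComplement.isImmersion (F := Unit) fun p ↦
    isImmersionAtOfComplement_periodicLift (K.contDiff_tubeδ _) (K.tubeδ_add_two_pi _)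
      (K.norm_tubeδ _) fun t _ ↦
        K.fderiv_tubeδ_injective hδ (hδr.trans K.tubularRadius_le_jacobiRadius) (t, p.2)

variable {K} in
/-- The tubular map of radius `δ ≤ tubularRadius` is an open embedding. [folklore] -/
theorem isOpenEmbedding_tubularMapOfRadius {δ : ℝ} (hδ : 0 < δ) (hδr : δ ≤ K.tubularRadius) :
    Topology.IsOpenEmbedding (K.tubularMapOfRadius δ) :=
  (isLocalDiffeomorph_tubularMapOfRadius hδ hδr).isLocalHomeomorph.isOpenEmbedding_of_injective
    (tubularMapOfRadius_injective hδ hδr)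

variable {K} in
/-- The tubular map of radius `δ ≤ tubularRadius` is a smooth embedding. [folklore] -/
theorem isSmoothEmbedding_tubularMapOfRadius {δ : ℝ} (hδ : 0 < δ) (hδr : δ ≤ K.tubularRadius) :
    Manifold.IsSmoothEmbedding 𝓘₁₂ (𝓡 3) ∞ (K.tubularMapOfRadius δ) :=
  ⟨isImmersion_tubularMapOfRadius hδ hδr, (isOpenEmbedding_tubularMapOfRadius hδ hδr).isEmbedding⟩

variable {K} in
/-- The tubular map of radius `δ ≤ tubularRadius` is positively oriented in the sense of
`Literature.Topology.FourManifolds.Knot.TubularNbhd.det_pos` (`det_deriv_tubeδ_pos`). [folklore] -/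
theorem det_pos_tubularMapOfRadius {δ : ℝ} (hδ : 0 < δ) (hδr : δ ≤ K.tubularRadius) (θ : ℝ)
    (w : 𝔼 2) :
    0 < Matrix.det (Matrix.of
      ![⇑(K.tubularMapOfRadius δ (circlePoint θ, w) : 𝔼 4),
        ⇑(deriv (fun t : ℝ ↦ (K.tubularMapOfRadius δ (circlePoint t, w) : 𝔼 4)) θ),
        ⇑(deriv (fun s : ℝ ↦
          (K.tubularMapOfRadius δ (circlePoint θ, w + EuclideanSpace.single 0 s) : 𝔼 4)) 0),
        ⇑(deriv (fun s : ℝ ↦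
          (K.tubularMapOfRadius δ (circlePoint θ, w + EuclideanSpace.single 1 s) : 𝔼 4)) 0)]) := by
  simp only [coe_tubularMapOfRadius_circlePoint]
  exact K.det_deriv_tubeδ_pos hδ (hδr.trans K.tubularRadius_le_jacobiRadius) θ w

variable {K} in
/-- **The oriented tubular neighbourhood of radius `δ`** of a knot, `0 < δ ≤ tubularRadius K`
(Hirsch (1976), §4.5, Thm. 5.1–5.2: the squeezed tube is a full tubular neighbourhood for every
small radius). [cite: Hirsch1976, §4.5 Thm 5.2] -/
def tubularNbhdOfRadius {δ : ℝ} (hδ : 0 < δ) (hδr : δ ≤ K.tubularRadius) : Knot.TubularNbhd K where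
  toFun := K.tubularMapOfRadius δ
  isSmoothEmbedding := isSmoothEmbedding_tubularMapOfRadius hδ hδr
  apply_zero := K.tubularMapOfRadius_zero δ
  det_pos := det_pos_tubularMapOfRadius hδ hδr

variable {K} in
/-- The tubular neighbourhood of radius `δ` as a function. [folklore] -/
@[simp] theorem coe_tubularNbhdOfRadius {δ : ℝ} (hδ : 0 < δ) (hδr : δ ≤ K.tubularRadius) :
    ⇑(tubularNbhdOfRadius hδ hδr) = K.tubularMapOfRadius δ := rfl

variable {K} in
/-- The image of the tubular neighbourhood of radius `δ` lies in `ν̂ (𝕊¹ × B (0, δ))`. [folklore] -/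
theorem range_tubularNbhdOfRadius_subset {δ : ℝ} (hδ : 0 < δ) (hδr : δ ≤ K.tubularRadius) :
    range ⇑(tubularNbhdOfRadius hδ hδr) ⊆ K.preTubularMap '' (univ ×ˢ Metric.ball (0 : 𝔼 2) δ) :=
  K.range_tubularMapOfRadius_subset hδ

end SphereEmbedding

/-! ### Thin tubular neighbourhoods -/

/-- **Thin tubes.** Every open subset of `𝕊³` containing the knot contains the image of an
oriented tubular neighbourhood of the knot: the pre-tubular map `ν̂ : 𝕊¹ × ℝ² → 𝕊³` is continuous
and equal to `K` on the zero section, so `ν̂⁻¹ U ⊇ 𝕊¹ × B (0, ε)` for some `ε > 0` (tube lemma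
over the compact circle), and the tubular neighbourhood of radius `min ε (tubularRadius K)` has
image in `ν̂ (𝕊¹ × B (0, ε)) ⊆ U`. Hirsch (1976), §4.5, Thm. 5.1 (tubular neighbourhoods inside a
prescribed neighbourhood). [cite: Hirsch1976, §4.5 Thm 5.1] -/
theorem Knot.exists_tubularNbhd_range_subset (K : Knot) {U : Set (𝕊 3)} (hU : IsOpen U)
    (hKU : range K ⊆ U) : ∃ ν : Knot.TubularNbhd K, range ν ⊆ U := by
  have hpre : IsOpen (K.preTubularMap ⁻¹' U) := hU.preimage K.continuous_preTubularMap
  have hzero : (univ : Set (𝕊 1)) ×ˢ ({0} : Set (𝔼 2)) ⊆ K.preTubularMap ⁻¹' U := by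
    rintro ⟨u, w⟩ ⟨-, hw⟩
    rw [mem_singleton_iff] at hw
    subst hw
    rw [mem_preimage, SphereEmbedding.preTubularMap_zero]
    exact hKU (mem_range_self u)
  obtain ⟨u, v, -, hv, hsu, h0v, huv⟩ :=
    generalized_tube_lemma isCompact_univ isCompact_singleton hpre hzero
  obtain ⟨ε, hε, hball⟩ := Metric.isOpen_iff.1 hv 0 (h0v (mem_singleton 0))
  refine ⟨SphereEmbedding.tubularNbhdOfRadius (lt_min hε K.tubularRadius_pos) (min_le_right _ _),
    ?_⟩
  refine (SphereEmbedding.range_tubularNbhdOfRadius_subset _ _).trans ?_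
  rintro _ ⟨⟨x, w⟩, ⟨-, hw⟩, rfl⟩
  have hw' : w ∈ v := hball (Metric.ball_subset_ball (min_le_left _ _) hw)
  exact huv (mk_mem_prod (hsu (mem_univ x)) hw')

/-! ### Pairwise disjoint tubular neighbourhoods of the components of a link -/

namespace Link

variable {ι : Type*} [Finite ι] (L : Link ι)

/-- **The components of a link have pairwise disjoint open neighbourhoods**: finitely many
pairwise disjoint compact subsets of a Hausdorff space are separated by pairwise disjoint open
sets (separate each pair and intersect). [folklore] -/
theorem exists_isOpen_pairwise_disjoint :
    ∃ U : ι → Set (𝕊 3), (∀ i, IsOpen (U i)) ∧ (∀ i, range (L.component i) ⊆ U i) ∧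
      Pairwise fun i j ↦ Disjoint (U i) (U j) := by
  classical
  -- separate each ordered pair of distinct components
  have hsep : ∀ i j, i ≠ j →
      SeparatedNhds (range (L.component i)) (range (L.component j)) := fun i j hij ↦
    SeparatedNhds.of_isCompact_isCompact (L.component i).isCompact_range
      (L.component j).isCompact_range (L.disjoint hij)
  choose V W hV hW hKV hKW hVW using hsep
  -- total versions (junk value `univ` on the diagonal)
  obtain ⟨V', hV'⟩ : ∃ V' : ι → ι → Set (𝕊 3), ∀ i j, V' i j = if h : i ≠ j then V i j h else univ :=
    ⟨_, fun _ _ ↦ rfl⟩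
  obtain ⟨W', hW'⟩ : ∃ W' : ι → ι → Set (𝕊 3), ∀ i j, W' i j = if h : i ≠ j then W i j h else univ :=
    ⟨_, fun _ _ ↦ rfl⟩
  have hV'o : ∀ i j, IsOpen (V' i j) := fun i j ↦ by
    rw [hV' i j]
    by_cases h : i ≠ j
    · rw [dif_pos h]; exact hV i j h
    · rw [dif_neg h]; exact isOpen_univ
  have hW'o : ∀ i j, IsOpen (W' i j) := fun i j ↦ by
    rw [hW' i j]
    by_cases h : i ≠ j
    · rw [dif_pos h]; exact hW i j h
    · rw [dif_neg h]; exact isOpen_univ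
  have hKV' : ∀ i j, range (L.component i) ⊆ V' i j := fun i j ↦ by
    rw [hV' i j]
    by_cases h : i ≠ j
    · rw [dif_pos h]; exact hKV i j h
    · rw [dif_neg h]; exact subset_univ _
  have hKW' : ∀ i j, range (L.component j) ⊆ W' i j := fun i j ↦ by
    rw [hW' i j]
    by_cases h : i ≠ j
    · rw [dif_pos h]; exact hKW i j h
    · rw [dif_neg h]; exact subset_univ _
  refine ⟨fun i ↦ ⋂ j, V' i j ∩ W' j i, fun i ↦ ?_, fun i ↦ ?_, fun i j hij ↦ ?_⟩
  · exact isOpen_iInter_of_finite fun j ↦ (hV'o i j).inter (hW'o j i)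
  · exact subset_iInter fun j ↦ subset_inter (hKV' i j) (hKW' j i)
  · have hi : (⋂ k, V' i k ∩ W' k i) ⊆ V i j hij := by
      refine (iInter_subset _ j).trans (inter_subset_left.trans ?_)
      rw [hV' i j, dif_pos hij]
    have hj : (⋂ k, V' j k ∩ W' k j) ⊆ W i j hij := by
      refine (iInter_subset _ i).trans (inter_subset_right.trans ?_)
      rw [hW' i j, dif_pos hij]
    exact Set.disjoint_of_subset hi hj (hVW i j hij)

/-- **Every link with finitely many components has pairwise disjoint oriented tubular
neighbourhoods of its components**: thin tubes (`Knot.exists_tubularNbhd_range_subset`) inside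
pairwise disjoint open neighbourhoods of the components (`exists_isOpen_pairwise_disjoint`).
This is the first datum of the relational Dehn surgery `Literature.Topology.FourManifolds.IsIntegralSurgeryLink` on a link.
Rolfsen, *Knots and Links* (1976), §9.F (surgery instructions: disjoint tubular neighbourhoods
of the components); Hirsch (1976), §4.5. [cite: Rolfsen1976, §9.F] -/
theorem exists_tubularNbhd_pairwise_disjoint :
    ∃ ν : ∀ i, Knot.TubularNbhd (L.component i),
      Pairwise fun i j ↦ Disjoint (range (ν i)) (range (ν j)) := by
  obtain ⟨U, hU, hKU, hdisj⟩ := L.exists_isOpen_pairwise_disjoint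
  choose ν hν using fun i ↦ (L.component i).exists_tubularNbhd_range_subset (hU i) (hKU i)
  exact ⟨ν, fun i j hij ↦ Set.disjoint_of_subset (hν i) (hν j) (hdisj hij)⟩

end Link

end Literature.Topology.FourManifolds
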